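import Literature.MathematicalPhysics.QuantumFieldTheory.Balaban1983to89.B8Prop5ContractionKLevelSrc
import Literature.MathematicalPhysics.QuantumFieldTheory.Balaban1983to89.B8Prop5GaugeParamKLevel

/-!
# `Balaban1983to89.B8Prop5GaugeParamKLevelSrc` — [Balaban1985RegularSpaces] Sect. D pp. 93–94 ∕ Theorem 8 p. 101: THE GAUGE PARAMETER `λ′` OF
# PROPOSITION 5 AT `k` LEVELS **WITH A SOURCE** — `B8Prop5GaugeParamKLevel.gaugeParam_kLevel` (JOIN-A) re-run on the sourced contraction engine
# `B8Prop5ContractionKLevelSrc` (`W_λ ↦ W_λ − f`)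

statement-level skeleton of published theorems with citation tags; proofs where landed; nothing here is a claim about the Yang–Mills mass gap

T. Bałaban, *Spaces of regular gauge field configurations on a lattice and gauge fixing conditions*, Commun. Math. Phys. **99** (1985) 75–102
`[Balaban1985RegularSpaces]` ("B8"; journal page = PDF page + 74): Prop. 5 p. 94, (1.100)–(1.108) pp. 93–94, (1.113)–(1.120) pp. 95–96, Thm 8 (1.146) p. 101.

## WHY THIS FILE (cell `pub-ymgap`, HUMAN RULING D-0062; R134 seat `pub-ymgap-dag-n05-d` g5, DAG node N05 = [B8]; count-neutral)

Second brick of the sourced Proposition-5 providers behind the N05 knit's sockets `SP5base`∕`SP5`∕`SP5u` (Prop. 5 ∃∕! at the sourced gauge condition (1.146)):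
the un-sourced chain is ENGINE (`B8Prop5ContractionKLevel`) → REALITY (`B8Prop5Reality`) → JOIN-A (`B8Prop5GaugeParamKLevel.gaugeParam_kLevel`: the contraction
instantiated at `λ′ = λ + H_c λ`, `Eterm λ = ΔH_c λ`, output in the consumer's currency) → JOIN-B (`B8Prop5JoinHFP`, multiplier form + (1.29)) → Sect. E local ∕ RD →
socket assembly.  `B8Prop5ContractionKLevelSrc` (this seat) is the sourced ENGINE + REALITY; THIS FILE is the sourced JOIN-A — `gaugeParam_kLevel` VERBATIM with the
three engine calls re-pointed to `propFive_fixedPoint_kLevel_src` ∕ `_spec` ∕ `_selfAdjoint`, the source `f` entering as a fixed function with finite `|f|₍₋₂₎` on the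
`Ω_j` (`Bd2 … f m_f`), Hermitian there (the currency seat n05-c g5's `B8LeafModelZd3SourceReality` shows necessary), and the two smallness windows read at `h₂ + m_f∕2`
(the engine books the source's size in the `mE` slot: `mWc(mE) + m_f = mWc(mE + m_f∕2)`).  The §1 instantiation lemmas of `B8Prop5GaugeParamKLevel` (`gpar_size`,
`gpar_grad`, `gpar_lip`, `isSelfAdjoint_covLap`) are used BY NAME.

WHAT THIS FILE PROVES (kernel, 0 sorry, ONE theorem, no `def`): ★ `gaugeParam_kLevel_src` — the fixed point `s` of the SOURCED (1.100) and the gauge parameter `s′`,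
`λ_{s′} = λ_s + H_c λ_s`, `‖s′‖ ≤ α₄`, Hermitian, `= 0` off `Ω₀`, with the Neumann identity WITH SOURCE `Z′ + V_{λ′}(RZ′) = W_{λ′} − f` on every `Ω_j`.
NEXT for the provider lineage (not here): JOIN-B with source (`B8Prop5JoinHFP.hFP_kLevel_of179` re-run: from the identity above, `D*A₁ − f = (1 − R)Z′`, so the
multiplier form of (1.146) follows by `B8Prop5KLevelLetters.multiplier_iff_of_whyZ` ∕ `B8Eq195Linear` with `N λ := N₀ λ − f`), then the Sect.-E-local ∕ RD ∕ socket layers.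

HONEST SCOPE.  Instantiation bookkeeping over two landed modules and one of this seat's; the letters, `H_c`'s sizes, the datum's and the source's sizes are displayed
hypotheses; the multiplier clause and (1.29) are NOT here.  Count-neutral; N05 NOT discharged; one finite `T⁴` programme at fixed `ε`, Bałaban as printed — nothing
continuum ∕ ℝ⁴ ∕ OS ∕ mass-gap ∕ Clay.  No `sorry`, no definition.  Unit `pub-ymgap-dag-n05-d` (g5), 2026-08-27.

[cite: Balaban1985RegularSpaces, Prop. 5 (1.107)–(1.108) p.94, (1.100)–(1.103) p.93, (1.113)–(1.120) pp.95–96, Thm 8 (1.146) p.101]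
-/

noncomputable section

open NormedSpace Metric Set Filter Topology
open Complex (I)

namespace Literature.MathematicalPhysics.QuantumFieldTheory.Balaban1983to89.B8Prop5GaugeParamKLevelSrc

open B7Prop1Explicit (e U1)
open B7Prop2Explicit (unitaryUnits mem_unitaryUnits unitaryUnits_le_U1)
open B7Eq78Linearization (conjR)
open B8Ineq132 (covDerivFwd covDeriv norm_conjR)
open B8Eq138LandauZd (covLap covDivB)
open B8LambdaSpaceKLevel (wt wt_pos wt_nonneg lamSubK lamOf lamOf_sub norm_lamOf_le weight_mul_norm_covDerivFwd_le mkLam lamOf_mkLam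
  norm_mkLam_le norm_le_iff norm_sub_le_iff covDerivFwd_add' covDerivFwd_sub')
open B8Prop5ContractionKLevel (Bd2 Zsol Vop Wsrc Mc Kc mWc KWc)
open B8Prop5ContractionKLevelSrc (PsiP5src propFive_fixedPoint_kLevel_src propFive_fixedPoint_kLevel_src_spec propFive_fixedPoint_kLevel_src_selfAdjoint)
open B8Prop5GaugeParamKLevel (gpar_size gpar_grad gpar_lip isSelfAdjoint_covLap)

-- `Site` alone could resolve to the torus sites of `Setup.lean`; re-export the `ℤ^d` sites of `B7Prop1Explicit`.
export B7Prop1Explicit (Site)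

variable {d : ℕ} {𝔸 : Type*} [CStarAlgebra 𝔸] [Nontrivial 𝔸]

/-! ## The gauge parameter `λ′` of Proposition 5 at `k` levels, with a source -/

section GaugeParam

variable {L k : ℕ} {η : ℝ} {Ω : ℕ → Set (Site d)} {Eb : ℕ → Set (Site d × Fin d)} {U₀ : Site d → Fin d → 𝔸ˣ}
  {A : Site d → Fin d → 𝔸} {DA : Site d → 𝔸}

/-- ★ **THE GAUGE PARAMETER OF PROPOSITION 5 AT `k` LEVELS, WITH A SOURCE** (Theorem 8's (1.146)) — `B8Prop5GaugeParamKLevel.gaugeParam_kLevel` VERBATIM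
on the sourced engine `B8Prop5ContractionKLevelSrc.propFive_fixedPoint_kLevel_src` (`Ψ_f`, `W ↦ W − f`): letters `G′`, `R`, the Sect. E correction `H_c`, the datum
`D*A`, `A` at a unitary `U₀`, bond sets, windows — PLUS a source `f` with `|f|₍₋₂₎ ≤ m_f` on the `Ω_j`, Hermitian there — and the two smallness conditions READ AT
`h₂ + m_f∕2`.  CONCLUSION: the fixed point `s` of the sourced (1.100) (`λ_s = G′(Ψ_f λ_s)`, `‖s‖ ≤ ¼α₄`) and the gauge parameter `s′` with `λ_{s′} = λ_s + H_c λ_s`,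
`‖s′‖ ≤ α₄` ((1.108)), `λ_{s′}` Hermitian and `= 0` off `Ω₀`, and the Neumann identity WITH SOURCE `Z′ + V_{λ′}(RZ′) = W_{λ′} − f` on every `Ω_j` (whence JOIN-B
reads `R(D*A₁ − f) = 0`, i.e. (1.146) in multiplier form, exactly as it reads `R(D*A₁) = 0` from the un-sourced identity).
[cite: Balaban1985RegularSpaces, Prop. 5 (1.107)–(1.108) p.94, (1.100)–(1.103) p.93, (1.113)–(1.120) pp.95–96, Thm 8 (1.146) p.101 («only some constants change»)] -/
theorem gaugeParam_kLevel_src (hL : 1 ≤ L) (hη : 0 < η) (hU₀ : ∀ x κ, U₀ x κ ∈ unitaryUnits 𝔸)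
    (hEbΩ : ∀ j, j ≤ k → ∀ x ∈ Ω j, ∀ μ : Fin d, (x, μ) ∈ Eb j ∧ (x - e μ, μ) ∈ Eb j)
    (Gp R Hc : (Site d → 𝔸) → (Site d → 𝔸))
    {α₄ BG BR h₀ h₁ h₂ l₀ l₁ l₂ cA cDA : ℝ}
    (hα₄ : 0 ≤ α₄) (hBG : 0 ≤ BG) (hBR : 0 ≤ BR) (hh₀ : 0 ≤ h₀) (hh₂ : 0 ≤ h₂) (hl₀ : 0 ≤ l₀) (hl₁ : 0 ≤ l₁)
    (hl₂ : 0 ≤ l₂) (hcA : 0 ≤ cA) (hcA' : cA ≤ 1 / 13) (hcDA : 0 ≤ cDA)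
    (ha₁' : α₄ / 4 + h₀ ≤ 1 / 24) (hb₁' : α₄ / 4 + h₁ ≤ 1 / 140) (hb₁ : 0 < α₄ / 4 + h₁) (hθ : 10 * (α₄ / 4 + h₀) * BR ≤ 1 / 2)
    (hh₀' : h₀ ≤ 3 * α₄ / 4) (hh₁' : h₁ ≤ 3 * α₄ / 4)
    -- letters
    (hG : ∀ (f : Site d → 𝔸) (m : ℝ), 0 ≤ m → Bd2 L η k Ω f m →
      (∀ x, ‖Gp f x‖ ≤ BG * m) ∧ ∀ j, j ≤ k → ∀ p ∈ Eb j, wt L η j * ‖covDerivFwd η U₀ p.2 (Gp f) p.1‖ ≤ BG * m)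
    (hGsub : ∀ f g : Site d → 𝔸, Gp (f - g) = Gp f - Gp g)
    (hGsupp : ∀ (f : Site d → 𝔸) (x : Site d), x ∉ Ω 0 → Gp f x = 0)
    (hGreal : ∀ f : Site d → 𝔸, (∀ j, j ≤ k → ∀ x ∈ Ω j, IsSelfAdjoint (f x)) → ∀ x, IsSelfAdjoint (Gp f x))
    (hRsub : ∀ f g : Site d → 𝔸, R (f - g) = R f - R g)
    (hRbd : ∀ (f : Site d → 𝔸) (m : ℝ), 0 ≤ m → Bd2 L η k Ω f m → Bd2 L η k Ω (R f) (BR * m))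
    (hRreal : ∀ f : Site d → 𝔸, (∀ j, j ≤ k → ∀ x ∈ Ω j, IsSelfAdjoint (f x)) → ∀ j, j ≤ k → ∀ x ∈ Ω j, IsSelfAdjoint (R f x))
    -- the Sect. E correction `H_c` (λ′ = λ + H_c λ)
    (hc0 : ∀ s : lamSubK η U₀ L k Eb, ‖s‖ ≤ α₄ / 4 → ∀ x, ‖Hc (lamOf s) x‖ ≤ h₀)
    (hc1 : ∀ s : lamSubK η U₀ L k Eb, ‖s‖ ≤ α₄ / 4 → ∀ j, j ≤ k → ∀ p ∈ Eb j, wt L η j * ‖covDerivFwd η U₀ p.2 (Hc (lamOf s)) p.1‖ ≤ h₁)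
    (hc2 : ∀ s : lamSubK η U₀ L k Eb, ‖s‖ ≤ α₄ / 4 → Bd2 L η k Ω (covLap η U₀ (Hc (lamOf s))) h₂)
    (hcL0 : ∀ s t : lamSubK η U₀ L k Eb, ‖s‖ ≤ α₄ / 4 → ‖t‖ ≤ α₄ / 4 → ∀ x, ‖Hc (lamOf s) x - Hc (lamOf t) x‖ ≤ l₀ * ‖s - t‖)
    (hcL1 : ∀ s t : lamSubK η U₀ L k Eb, ‖s‖ ≤ α₄ / 4 → ‖t‖ ≤ α₄ / 4 → ∀ j, j ≤ k → ∀ p ∈ Eb j,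
      wt L η j * ‖covDerivFwd η U₀ p.2 (Hc (lamOf s) - Hc (lamOf t)) p.1‖ ≤ l₁ * ‖s - t‖)
    (hcL2 : ∀ s t : lamSubK η U₀ L k Eb, ‖s‖ ≤ α₄ / 4 → ‖t‖ ≤ α₄ / 4 →
      Bd2 L η k Ω (covLap η U₀ (Hc (lamOf s)) - covLap η U₀ (Hc (lamOf t))) (l₂ * ‖s - t‖))
    (hcsa : ∀ s : lamSubK η U₀ L k Eb, ‖s‖ ≤ α₄ / 4 → (∀ x, IsSelfAdjoint (lamOf s x)) → ∀ x, IsSelfAdjoint (Hc (lamOf s) x))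
    (hcsupp : ∀ s : lamSubK η U₀ L k Eb, ‖s‖ ≤ α₄ / 4 → ∀ x, x ∉ Ω 0 → Hc (lamOf s) x = 0)
    -- the datum
    (hDA : Bd2 L η k Ω DA cDA) (hDAsa : ∀ j, j ≤ k → ∀ x ∈ Ω j, IsSelfAdjoint (DA x))
    (hA : ∀ j, j ≤ k → ∀ x ∈ Ω j, ∀ μ : Fin d,
      wt L η j * ‖A x μ‖ ≤ cA ∧ wt L η j * ‖conjR (U₀ (x - e μ) μ)⁻¹ (A (x - e μ) μ)‖ ≤ cA)
    (hAsa : ∀ x μ, IsSelfAdjoint (A x μ))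
    -- THE SOURCE of Theorem 8's (1.146): a fixed function with finite `|f|₍₋₂₎` on the `Ω_j`, Hermitian there (print: «f from the space R(U₀)»)
    {f : Site d → 𝔸} {mf : ℝ} (hmf : 0 ≤ mf) (hf : Bd2 L η k Ω f mf) (hfsa : ∀ j, j ≤ k → ∀ x ∈ Ω j, IsSelfAdjoint (f x))
    -- smallness (1.103)/(1.106) on the explicit constants of the contraction, READ AT `h₂ + m_f∕2` (the source's size booked in the `mE` slot)
    (h103 : BG * Mc d BR (α₄ / 4 + h₁) cA (h₂ + mf / 2) cDA ≤ α₄ / 4)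
    (h106 : BG * Kc d BR (α₄ / 4 + h₁) cA (h₂ + mf / 2) cDA l₂ (1 + l₀) (1 + l₁) ≤ 1 / 2) :
    ∃ s s' : lamSubK η U₀ L k Eb,
      ‖s‖ ≤ α₄ / 4 ∧
      lamOf s = Gp (PsiP5src η U₀ A DA f R (fun lam => lam + Hc lam) (fun lam => covLap η U₀ (Hc lam)) (lamOf s)) ∧
      lamOf s' = lamOf s + Hc (lamOf s) ∧ ‖s'‖ ≤ α₄ ∧ (∀ x, IsSelfAdjoint (lamOf s' x)) ∧ (∀ x, x ∉ Ω 0 → lamOf s' x = 0) ∧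
      (∀ j, j ≤ k → ∀ x ∈ Ω j,
        Zsol (Wsrc η U₀ A DA (lamOf s') (covLap η U₀ (Hc (lamOf s))) - f) (Vop (lamOf s')) R x +
          Vop (lamOf s') (R (Zsol (Wsrc η U₀ A DA (lamOf s') (covLap η U₀ (Hc (lamOf s))) - f) (Vop (lamOf s')) R)) x =
        Wsrc η U₀ A DA (lamOf s') (covLap η U₀ (Hc (lamOf s))) x - f x) := by
  set gpar : (Site d → 𝔸) → (Site d → 𝔸) := fun lam => lam + Hc lam with hgpar
  set Eterm : (Site d → 𝔸) → (Site d → 𝔸) := fun lam => covLap η U₀ (Hc lam) with hEterm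
  -- the displayed hypotheses of the contraction at (gpar, Eterm)
  have hg0 : ∀ s : lamSubK η U₀ L k Eb, ‖s‖ ≤ α₄ / 4 → ∀ j, j ≤ k → ∀ x ∈ Ω j, ‖gpar (lamOf s) x‖ ≤ α₄ / 4 + h₀ :=
    fun s hs j _ x _ => gpar_size hc0 s hs x
  have hg1 : ∀ s : lamSubK η U₀ L k Eb, ‖s‖ ≤ α₄ / 4 → ∀ j, j ≤ k → ∀ x ∈ Ω j, ∀ μ : Fin d,
      wt L η j * ‖covDerivFwd η U₀ μ (gpar (lamOf s)) x‖ ≤ α₄ / 4 + h₁ ∧ wt L η j * ‖covDeriv η U₀ μ (gpar (lamOf s)) x‖ ≤ α₄ / 4 + h₁ :=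
    fun s hs j hj x hx μ => gpar_grad hη hU₀ hEbΩ hc1 s hs hj hx μ
  have hgL : ∀ s t : lamSubK η U₀ L k Eb, ‖s‖ ≤ α₄ / 4 → ‖t‖ ≤ α₄ / 4 → ∀ j, j ≤ k → ∀ x ∈ Ω j,
      ‖gpar (lamOf s) x - gpar (lamOf t) x‖ ≤ (1 + l₀) * ‖s - t‖ ∧ ∀ μ : Fin d,
        wt L η j * ‖covDerivFwd η U₀ μ (gpar (lamOf s) - gpar (lamOf t)) x‖ ≤ (1 + l₁) * ‖s - t‖ ∧
        wt L η j * ‖covDeriv η U₀ μ (gpar (lamOf s) - gpar (lamOf t)) x‖ ≤ (1 + l₁) * ‖s - t‖ :=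
    fun s t hs ht j hj x hx => gpar_lip hη hU₀ hEbΩ hcL0 hcL1 s t hs ht hj hx
  have hE0 : ∀ s : lamSubK η U₀ L k Eb, ‖s‖ ≤ α₄ / 4 → Bd2 L η k Ω (Eterm (lamOf s)) h₂ := fun s hs => hc2 s hs
  have hEL : ∀ s t : lamSubK η U₀ L k Eb, ‖s‖ ≤ α₄ / 4 → ‖t‖ ≤ α₄ / 4 →
      Bd2 L η k Ω (Eterm (lamOf s) - Eterm (lamOf t)) (l₂ * ‖s - t‖) := fun s t hs ht => hcL2 s t hs ht
  -- the fixed point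
  obtain ⟨s, ⟨hs, hfix⟩, -⟩ := propFive_fixedPoint_kLevel_src (Ω := Ω) (Eb := Eb) (U₀ := U₀) (A := A) (DA := DA) (f := f) hL hη Gp R gpar Eterm
    hα₄ hBG hBR (by positivity) ha₁' hb₁ hb₁' hcA hcA' hcDA hh₂ hl₂ (by positivity) (by positivity) hmf hθ hG hGsub hRsub hRbd hg0 hg1 hgL hE0 hEL
    hDA hf hA h103 h106
  obtain ⟨hN, -, -, hoff⟩ := propFive_fixedPoint_kLevel_src_spec (Ω := Ω) (Eb := Eb) (U₀ := U₀) (A := A) (DA := DA) (f := f) hL hη Gp R gpar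
    Eterm hBR (by positivity) ha₁' hb₁ hb₁' hcA hcA' hcDA hh₂ hmf hθ hG hGsupp hRsub hRbd hg0 hg1 hE0 hDA hf hA hs hfix
  -- reality
  have hgsa : ∀ t : lamSubK η U₀ L k Eb, ‖t‖ ≤ α₄ / 4 → (∀ x, IsSelfAdjoint (lamOf t x)) → ∀ x, IsSelfAdjoint (gpar (lamOf t) x) :=
    fun t ht hsa x => (hsa x).add (hcsa t ht hsa x)
  have hEsa : ∀ t : lamSubK η U₀ L k Eb, ‖t‖ ≤ α₄ / 4 → (∀ x, IsSelfAdjoint (lamOf t x)) → ∀ j, j ≤ k → ∀ x ∈ Ω j,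
      IsSelfAdjoint (Eterm (lamOf t) x) := fun t ht hsa j _ x _ => isSelfAdjoint_covLap hU₀ (hcsa t ht hsa) x
  have hsa : ∀ x, IsSelfAdjoint (lamOf s x) :=
    propFive_fixedPoint_kLevel_src_selfAdjoint (Ω := Ω) (Eb := Eb) (U₀ := U₀) (A := A) (DA := DA) (f := f) hL hη hU₀ Gp R gpar Eterm hα₄
      hBG hBR (by positivity) ha₁' hb₁ hb₁' hcA hcA' hcDA hh₂ hl₂ (by positivity) (by positivity) hmf hθ hG hGsub hRsub hRbd hg0 hg1 hgL hE0 hEL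
      hDA hf hA h103 h106 hAsa hDAsa hfsa hgsa hEsa hRreal hGreal hs hfix
  -- the gauge parameter as a point of the λ-space
  have hb_lam : ∀ x, ‖gpar (lamOf s) x‖ ≤ α₄ := fun x => by
    have := gpar_size hc0 s hs x; simp only [hgpar] at this ⊢; linarith
  have hb_grad : ∀ j, j ≤ k → ∀ p ∈ Eb j, wt L η j * ‖covDerivFwd η U₀ p.2 (gpar (lamOf s)) p.1‖ ≤ α₄ := by
    intro j hj p hp
    have hw : 0 ≤ wt L η j := wt_nonneg L hη.le j
    simp only [hgpar]
    rw [covDerivFwd_add']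
    calc wt L η j * ‖covDerivFwd η U₀ p.2 (lamOf s) p.1 + covDerivFwd η U₀ p.2 (Hc (lamOf s)) p.1‖
        ≤ wt L η j * (‖covDerivFwd η U₀ p.2 (lamOf s) p.1‖ + ‖covDerivFwd η U₀ p.2 (Hc (lamOf s)) p.1‖) :=
          mul_le_mul_of_nonneg_left (norm_add_le _ _) hw
      _ ≤ α₄ / 4 + h₁ := by rw [mul_add]; exact add_le_add ((weight_mul_norm_covDerivFwd_le hη.le s hj hp).trans hs) (hc1 s hs j hj p hp)
      _ ≤ α₄ := by linarith
  set s' : lamSubK η U₀ L k Eb := mkLam hη.le (gpar (lamOf s)) hb_lam hb_grad with hs'def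
  have hs'lam : lamOf s' = gpar (lamOf s) := lamOf_mkLam hη.le _ hb_lam hb_grad
  refine ⟨s, s', hs, hfix, hs'lam, ?_, ?_, ?_, ?_⟩
  · exact (norm_mkLam_le hη.le _ hb_lam hb_grad).trans (max_le le_rfl le_rfl)
  · intro x; rw [hs'lam]; exact hgsa s hs hsa x
  · intro x hx
    rw [hs'lam]; simp only [hgpar, Pi.add_apply]
    rw [hoff x hx, hcsupp s hs x hx, add_zero]
  · intro j hj x hx
    rw [hs'lam]
    exact hN j hj x hx

end GaugeParam

end Literature.MathematicalPhysics.QuantumFieldTheory.Balaban1983to89.B8Prop5GaugeParamKLevelSrc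

end
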